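import Mathlib
import Literature.NumberTheory.LFunctions.Zhang2022.SkeletonSetting
import Literature.NumberTheory.LFunctions.SiegelTheorem
import Literature.NumberTheory.LFunctions.HeckeLOneBound
import Literature.NumberTheory.LFunctions.DirichletLFunctionInverseBound
import HarnessLib

/-!
# Zhang (2022), §1 (Introduction): the displayed background statements, typed — Landau–Page,
# Siegel's theorem and its zero-free form, Hecke's (1.1) — all PROVED from the tree

Topic `Literature/NumberTheory/LFunctions/Zhang2022` (Landau–Siegel audit tree; verdict-neutral).
Y. Zhang, *Discrete mean estimates and the Landau–Siegel zero*, arXiv:2211.02515v1 (2022)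
[Zhang2022LandauSiegel] — **an unrefereed manuscript under adjudication; nothing in this file
asserts or denies its Theorems 1–2** (those are the `Prop`s `Skeleton.Theorem1`, `Skeleton.Theorem2`
of `SkeletonSetting`, stated not asserted). This file types the displayed statements of the
INTRODUCTION (§1, PDF pp. 2–3, tex L169–247) — the classical background the manuscript quotes —
in the manuscript's own shape, for a real primitive character `χ` to the modulus `D ≥ 3`
(Mathlib: `χ.IsQuadratic`, `χ.IsPrimitive`, `χ.LFunction`). Every one of them is a published
theorem that the tree ALREADY PROVES in Montgomery–Vaughan's form; here they are re-derived in the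
printed form, so the §1 nodes of the campaign DAG are born discharged and NO named fact is introduced:

| DAG node | p. | printed statement | decl | status |
|---|---|---|---|---|
| `Z22:§1.u001` | 2 | "`L(s,χ)` has at most one real and simple zero `ρ̃` satisfying `1 − ρ̃ < c₀(log D)⁻¹`" | `landauPage` | PROVED (tree `DirichletZFR.exists_inv_LFunction_bounds`, MV Thm 11.3–11.4) |
| — | 2 | "Such a zero is called the Landau-Siegel zero" | `HasLandauSiegelZero` | definition |
| `Z22:§1.u002` | 2 | Siegel [19]: "`L(1,χ) > C₁(ε)D^{−ε}`" | `siegel` | PROVED (tree `siegel_lower_bound_holds`) |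
| `Z22:§1.u003` | 3 | "`L(σ,χ) ≠ 0` if `σ > 1 − C₂(ε)D^{−ε}`" | `siegel_zeroFree` | PROVED (Siegel + MV (11.10), tree `MontgomeryVaughan2007_thm11_4_LOne_exceptional_holds`) |
| `Z22:(1.1)` | 3 | "the non-existence of the Landau-Siegel zero implies `L(1,χ) ≫ (log D)⁻¹`" | `eq11` | PROVED (Hecke; tree `MontgomeryVaughan2007_thm11_4_LOne_holds`) |
| `Z22:§1.u004` | 3 | Goldfeld [10], Gross–Zagier [12]: `χ(−1) = −1 ⇒ L(1,χ) ≫ D^{−1/2}(log D)^{1−ε}`, effective | — | NOTED only (expository context, not an input of the manuscript's argument; not restated as a fact) |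
| — | 3 | Granville–Stark [11]: uniform *abc* ⇒ (1.1) for `χ(−1) = −1` | — | NOTED only (cf. the tree's `Literature.Barriers.ABC.UniformABCImpliesNoSiegelZeros_holds_of`) |
| `Z22:§1.u005–u007` | 3 | the displays of Theorems 1 and 2 | — | = `Skeleton.Theorem1`, `Skeleton.Theorem2` (`SkeletonSetting`, landed); not restated |

Design notes. (1) "the Landau–Siegel zero" in (1.1) is the zero of the opening sentence, i.e.
relative to ITS absolute constant `c₀`; (1.1) is typed with that `c₀` existentially quantified
together with the implied constant (`eq11`), which is exactly Hecke's theorem (Landau 1918;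
Montgomery–Vaughan (11.7) at `s = 1`). (2) Siegel's theorem is printed with a strict `>`; the tree's
`siegel_lower_bound` has `≥` for `Re L(1,χ)` — halving the constant gives the strict form for the
norm. (3) The zero-free form `σ > 1 − C₂(ε)D^{−ε}` ("This implies") is DERIVED here as the manuscript
says, from Siegel's bound at `ε/2` and Montgomery–Vaughan's `L(1,χ) ≪ (1 − β₁)(log q)²` for an
exceptional zero, with `log²D ≤ 16ε⁻²D^{ε/2}` (`Real.log_le_rpow_div`).

## References

* Y. Zhang, arXiv:2211.02515v1 (2022), §1 pp. 2–3. [cite: Zhang2022LandauSiegel, §1 pp. 2–3]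
* H. L. Montgomery, R. C. Vaughan, *Multiplicative Number Theory I* (2007), Thms 11.3–11.4,
  (11.7), (11.10); §11.3 (Siegel). [cite: MontgomeryVaughan2007, Thms 11.3–11.4]
* C. L. Siegel, Acta Arith. 1 (1935). [cite: Siegel1935, main theorem]
-/

noncomputable section

open Complex Real

namespace Literature.NumberTheory.LFunctions.Zhang2022.Section1

/-! ## §1 p. 2: the Landau–Siegel zero -/

/-- **"Such a zero is called the Landau-Siegel zero"** (§1 p. 2): relative to the absolute constant
`c₀` of the opening sentence, `χ (mod D)` HAS a Landau–Siegel zero when `L(s,χ)` has a real zero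
`ρ̃ < 1` with `1 − ρ̃ < c₀(log D)⁻¹`. [cite: Zhang2022LandauSiegel, §1 p. 2] -/
def HasLandauSiegelZero (c₀ : ℝ) (D : ℕ) [NeZero D] (χ : DirichletCharacter ℂ D) : Prop :=
  ∃ ρ : ℝ, ρ < 1 ∧ χ.LFunction ρ = 0 ∧ 1 - ρ < c₀ * (Real.log D)⁻¹

/-- `log D > 1` for `D ≥ 3`. [folklore] -/
private theorem one_lt_log {D : ℕ} (hD : 3 ≤ D) : 1 < Real.log D := by
  have hD' : (3 : ℝ) ≤ D := by exact_mod_cast hD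
  calc (1 : ℝ) < Real.log 3 := by
        rw [Real.lt_log_iff_exp_lt (by norm_num)]
        exact Real.exp_one_lt_d9.trans (by norm_num)
    _ ≤ Real.log D := Real.log_le_log (by norm_num) hD'

/-- `log 4 ≤ 2 log D` for `D ≥ 3` (so `log D + log 4 ≤ 3 log D`). [folklore] -/
private theorem log_four_le {D : ℕ} (hD : 3 ≤ D) : Real.log 4 ≤ 2 * Real.log D := by
  have hD' : (3 : ℝ) ≤ D := by exact_mod_cast hD
  calc Real.log 4 ≤ Real.log 9 := Real.log_le_log (by norm_num) (by norm_num)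
    _ = 2 * Real.log 3 := by
        rw [show (9 : ℝ) = 3 ^ 2 by norm_num, Real.log_pow]; norm_num
    _ ≤ 2 * Real.log D := by gcongr

/-- **§1 p. 2, opening sentence (Landau, Page)** — DAG node `Z22:§1.u001`: "It is known that the
Dirichlet `L`-function `L(s,χ)` has at most one real and simple zero `ρ̃` satisfying
`1 − ρ̃ < c₀(log D)⁻¹` where `c₀ > 0` is an absolute constant": there is an absolute `c₀ > 0` such
that for every real primitive `χ` mod `D ≥ 3`, any two real zeros `ρ̃, ρ̃′` of `L(s,χ)` with
`1 − ρ̃, 1 − ρ̃′ < c₀(log D)⁻¹` coincide, and such a zero is simple (`L′(ρ̃,χ) ≠ 0`). PROVED from the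
tree's Montgomery–Vaughan Theorem 11.3/11.4 package `DirichletZFR.exists_inv_LFunction_bounds`
(clauses "unique" and "simple", threshold `1 − 2c/(log q + log 4)`; here `c₀ = c/2`, using
`log 4 ≤ 2 log D` for `D ≥ 3`).
[cite: Zhang2022LandauSiegel, §1 p. 2] [cite: MontgomeryVaughan2007, Thm 11.3] -/
theorem landauPage :
    ∃ c₀ : ℝ, 0 < c₀ ∧ ∀ (D : ℕ) [NeZero D] (χ : DirichletCharacter ℂ D), 3 ≤ D →
      χ.IsQuadratic → χ.IsPrimitive →
        (∀ ρ ρ' : ℝ, χ.LFunction ρ = 0 → χ.LFunction ρ' = 0 →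
          1 - ρ < c₀ * (Real.log D)⁻¹ → 1 - ρ' < c₀ * (Real.log D)⁻¹ → ρ = ρ') ∧
        (∀ ρ : ℝ, χ.LFunction ρ = 0 → 1 - ρ < c₀ * (Real.log D)⁻¹ →
          deriv χ.LFunction ρ ≠ 0) := by
  obtain ⟨c, hc, -, C, -, -, huniq, -, hB⟩ := DirichletZFR.exists_inv_LFunction_bounds
  refine ⟨c / 2, by positivity, fun D _ χ hD _ hp => ?_⟩
  have hne : χ ≠ 1 := Skeleton.ne_one_of_isPrimitive_of_three_le hp hD
  have hlog : 1 < Real.log D := one_lt_log hD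
  have hlog0 : 0 < Real.log D := by linarith
  -- the printed threshold `1 − c₀/log D` lies above Montgomery–Vaughan's `1 − 2c/(log D + log 4)`
  have hthr : ∀ ρ : ℝ, 1 - ρ < c / 2 * (Real.log D)⁻¹ →
      1 - 2 * c / (Real.log D + Real.log 4) < ρ := by
    intro ρ hρ
    have h4 : Real.log D + Real.log 4 ≤ 3 * Real.log D := by linarith [log_four_le hD]
    have hpos : 0 < Real.log D + Real.log 4 := by positivity
    have h1 : c / 2 * (Real.log D)⁻¹ ≤ 2 * c / (Real.log D + Real.log 4) := by
      rw [← div_eq_mul_inv, div_le_div_iff₀ hlog0 hpos]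
      nlinarith
    linarith
  refine ⟨fun ρ ρ' h0 h0' hρ hρ' => huniq D χ hne ρ ρ' h0 h0' (hthr ρ hρ) (hthr ρ' hρ'),
    fun ρ h0 hρ => (hB D χ hne ρ h0 (hthr ρ hρ)).1⟩

/-! ## §1 pp. 2–3: Siegel's theorem and its zero-free form -/

/-- **Siegel's theorem [19] as quoted, §1 p. 2** — DAG node `Z22:§1.u002`: "for any `ε > 0`, there
exists a positive number `C₁(ε)` such that `L(1,χ) > C₁(ε)D^{−ε}`" (every real primitive `χ` mod
`D ≥ 3`; `‖L(1,χ)‖`, which for real `χ` is the positive real number `L(1,χ)`). PROVED from the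
tree's `siegel_lower_bound_holds` (`C(ε)q^{−ε} ≤ Re L(1,χ)`; the strict form with `C₁ = C/2`).
[cite: Zhang2022LandauSiegel, §1 p. 2] [cite: Siegel1935, main theorem] -/
theorem siegel (ε : ℝ) (hε : 0 < ε) :
    ∃ C₁ : ℝ, 0 < C₁ ∧ ∀ (D : ℕ) [NeZero D] (χ : DirichletCharacter ℂ D), 3 ≤ D →
      χ.IsQuadratic → χ.IsPrimitive → C₁ * (D : ℝ) ^ (-ε) < ‖χ.LFunction 1‖ := by
  obtain ⟨C, hC, h⟩ := siegel_lower_bound_holds ε hε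
  refine ⟨C / 2, by positivity, fun D _ χ hD hq hp => ?_⟩
  have hD0 : (0 : ℝ) < D := by exact_mod_cast (show 0 < D by omega)
  have hpow : 0 < (D : ℝ) ^ (-ε) := Real.rpow_pos_of_pos hD0 _
  have h1 := h D hD χ hq hp
  have h2 : (χ.LFunction 1).re ≤ ‖χ.LFunction 1‖ := Complex.re_le_norm _
  have h3 : C / 2 * (D : ℝ) ^ (-ε) < C * (D : ℝ) ^ (-ε) :=
    mul_lt_mul_of_pos_right (by linarith) hpow
  linarith

/-- `log²D ≤ 16ε⁻²·D^{ε/2}` for `D > 0`, `ε > 0` (from `log x ≤ x^δ/δ` at `δ = ε/4`). [folklore] -/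
private theorem log_sq_le_rpow {D ε : ℝ} (hD : 1 ≤ D) (hε : 0 < ε) :
    Real.log D ^ 2 ≤ 16 / ε ^ 2 * D ^ (ε / 2) := by
  have hD0 : 0 ≤ D := by linarith
  have hlog0 : 0 ≤ Real.log D := Real.log_nonneg hD
  have h := Real.log_le_rpow_div hD0 (by positivity : 0 < ε / 4)
  have hpow0 : 0 ≤ D ^ (ε / 4) := Real.rpow_nonneg hD0 _
  calc Real.log D ^ 2 ≤ (D ^ (ε / 4) / (ε / 4)) ^ 2 := pow_le_pow_left₀ hlog0 h 2
    _ = 16 / ε ^ 2 * (D ^ (ε / 4) * D ^ (ε / 4)) := by ring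
    _ = 16 / ε ^ 2 * D ^ (ε / 2) := by
        rw [← Real.rpow_add (by linarith : (0:ℝ) < D)]; ring_nf

/-- **Siegel's zero-free form as quoted, §1 pp. 2–3** — DAG node `Z22:§1.u003`: "This implies, for
any `ε > 0`, that there exists a positive number `C₂(ε)` such that `L(σ,χ) ≠ 0` if
`σ > 1 − C₂(ε)D^{−ε}`" (every real primitive `χ` mod `D ≥ 3`, real `σ`). PROVED as the manuscript
indicates: a zero `σ < 1` that close to `1` is either outside Montgomery–Vaughan's exceptional
region — impossible once `C₂ ≤ cε/3`, since `c/log 4D ≥ (cε/3)D^{−ε}` — or an exceptional zero, and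
then (11.10) `L(1,χ) ≤ C(1 − σ)log²D < C·C₂D^{−ε}·16ε⁻²D^{ε/2}` contradicts Siegel's bound at `ε/2`.
[cite: Zhang2022LandauSiegel, §1 pp. 2–3] [cite: MontgomeryVaughan2007, Thm 11.4 (11.10)] -/
theorem siegel_zeroFree (ε : ℝ) (hε : 0 < ε) :
    ∃ C₂ : ℝ, 0 < C₂ ∧ ∀ (D : ℕ) [NeZero D] (χ : DirichletCharacter ℂ D), 3 ≤ D →
      χ.IsQuadratic → χ.IsPrimitive → ∀ σ : ℝ, 1 - C₂ * (D : ℝ) ^ (-ε) < σ → χ.LFunction σ ≠ 0 := by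
  obtain ⟨S, hS, hSie⟩ := siegel (ε / 2) (by positivity)
  obtain ⟨c, hc, C₁, C, hC₁, hC, hE⟩ := MontgomeryVaughan2007_thm11_4_LOne_exceptional_holds
  refine ⟨min (c * ε / 3) (S * ε ^ 2 / (16 * C)), lt_min (by positivity) (by positivity),
    fun D _ χ hD hq hp σ hσ hzero => ?_⟩
  have hne : χ ≠ 1 := Skeleton.ne_one_of_isPrimitive_of_three_le hp hD
  have hD3 : (3 : ℝ) ≤ D := by exact_mod_cast hD
  have hD0 : (0 : ℝ) < D := by linarith
  have hD1 : (1 : ℝ) ≤ D := by linarith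
  have hlog : 1 < Real.log D := one_lt_log hD
  have hlog0 : 0 < Real.log D := by linarith
  have hpow : 0 < (D : ℝ) ^ (-ε) := Real.rpow_pos_of_pos hD0 _
  set C₂ : ℝ := min (c * ε / 3) (S * ε ^ 2 / (16 * C)) with hC₂
  have hC₂0 : 0 < C₂ := lt_min (by positivity) (by positivity)
  -- `σ < 1`: `L(σ,χ) ≠ 0` for `σ ≥ 1`
  have hσ1 : σ < 1 := by
    by_contra h
    push Not at h
    exact χ.LFunction_ne_zero_of_one_le_re (Or.inl hne) (by simpa using h) hzero
  -- `D^{ε}/log D ≥ ε` and `log(4D) ≤ 3 log D`, so `C₂ D^{−ε} ≤ c/log(4D)`: the zero is exceptional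
  have hDε : Real.log D ≤ (D : ℝ) ^ ε / ε := Real.log_le_rpow_div hD0.le hε
  have h4D0 : 0 < Real.log (4 * D) := Real.log_pos (by linarith)
  have h4D : Real.log (4 * D) ≤ 3 * Real.log D := log_four_mul_le_three_mul_log (by linarith)
  have hrpow_inv : (D : ℝ) ^ (-ε) = ((D : ℝ) ^ ε)⁻¹ := Real.rpow_neg hD0.le ε
  have hDεpos : 0 < (D : ℝ) ^ ε := Real.rpow_pos_of_pos hD0 _
  have hexc : 1 - c / Real.log (4 * D) < σ := by
    have h1 : C₂ * (D : ℝ) ^ (-ε) ≤ c * ε / 3 * (D : ℝ) ^ (-ε) :=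
      mul_le_mul_of_nonneg_right (min_le_left _ _) hpow.le
    -- `(cε/3) D^{−ε} ≤ c/(3 log D) ≤ c/log(4D)`
    have h2 : c * ε / 3 * (D : ℝ) ^ (-ε) ≤ c / (3 * Real.log D) := by
      rw [hrpow_inv, div_eq_mul_inv c (3 * Real.log D)]
      have : ε * ((D : ℝ) ^ ε)⁻¹ ≤ (Real.log D)⁻¹ := by
        rw [← div_eq_mul_inv, ← one_div, div_le_div_iff₀ hDεpos hlog0]
        have := (le_div_iff₀ hε).mp hDε
        linarith
      calc c * ε / 3 * ((D : ℝ) ^ ε)⁻¹ = c / 3 * (ε * ((D : ℝ) ^ ε)⁻¹) := by ring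
        _ ≤ c / 3 * (Real.log D)⁻¹ := by gcongr
        _ = c * (3 * Real.log D)⁻¹ := by rw [mul_inv]; ring
    have h3 : c / (3 * Real.log D) ≤ c / Real.log (4 * D) :=
      div_le_div_of_nonneg_left hc.le h4D0 h4D
    linarith
  -- (11.10): `L(1,χ) ≤ C(1 − σ)log²D`, and Siegel at `ε/2`
  have hup := (hE D χ hne hq σ hexc hσ1 hzero).2
  have hlow := hSie D χ hD hq hp
  have hlogsq := log_sq_le_rpow hD1 hε
  have h1σ : 1 - σ < C₂ * (D : ℝ) ^ (-ε) := by linarith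
  have hC₂' : C₂ ≤ S * ε ^ 2 / (16 * C) := min_le_right _ _
  -- chain: `‖L(1,χ)‖ ≤ C(1−σ)log²D < C·C₂D^{−ε}·(16/ε²)D^{ε/2} ≤ S·D^{−ε/2}`
  have hstep : C * (1 - σ) * Real.log D ^ 2 < C * (C₂ * (D : ℝ) ^ (-ε)) * (16 / ε ^ 2 * (D : ℝ) ^ (ε / 2)) := by
    have hlogsq0 : 0 < Real.log D ^ 2 := by positivity
    calc C * (1 - σ) * Real.log D ^ 2 < C * (C₂ * (D : ℝ) ^ (-ε)) * Real.log D ^ 2 := by gcongr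
      _ ≤ C * (C₂ * (D : ℝ) ^ (-ε)) * (16 / ε ^ 2 * (D : ℝ) ^ (ε / 2)) := by gcongr
  have hcomb : C * (C₂ * (D : ℝ) ^ (-ε)) * (16 / ε ^ 2 * (D : ℝ) ^ (ε / 2))
      ≤ S * (D : ℝ) ^ (-(ε / 2)) := by
    have hDD : (D : ℝ) ^ (-ε) * (D : ℝ) ^ (ε / 2) = (D : ℝ) ^ (-(ε / 2)) := by
      rw [← Real.rpow_add hD0]; ring_nf
    have hpow2 : 0 < (D : ℝ) ^ (-(ε / 2)) := Real.rpow_pos_of_pos hD0 _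
    calc C * (C₂ * (D : ℝ) ^ (-ε)) * (16 / ε ^ 2 * (D : ℝ) ^ (ε / 2))
        = (16 * C / ε ^ 2 * C₂) * ((D : ℝ) ^ (-ε) * (D : ℝ) ^ (ε / 2)) := by ring
      _ = (16 * C / ε ^ 2 * C₂) * (D : ℝ) ^ (-(ε / 2)) := by rw [hDD]
      _ ≤ (16 * C / ε ^ 2 * (S * ε ^ 2 / (16 * C))) * (D : ℝ) ^ (-(ε / 2)) := by gcongr
      _ = S * (D : ℝ) ^ (-(ε / 2)) := by field_simp
  linarith

/-! ## §1 p. 3: (1.1) -/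

/-- **(1.1), §1 p. 3 (Hecke; "see [9]")** — DAG node `Z22:(1.1)`: "the non-existence of the
Landau-Siegel zero implies `L(1,χ) ≫ (log D)⁻¹`": with the Landau–Siegel zero understood relative
to an absolute constant `c₀ > 0` as in the opening sentence (`HasLandauSiegelZero c₀`), there are
absolute `c₀, c₁ > 0` such that every real primitive `χ` mod `D ≥ 3` WITHOUT a Landau–Siegel zero
has `‖L(1,χ)‖ ≥ c₁(log D)⁻¹`. PROVED from the tree's Hecke bound
`MontgomeryVaughan2007_thm11_4_LOne_holds` (Montgomery–Vaughan (11.7) at `s = 1`), `c₀ = 2c`.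
[cite: Zhang2022LandauSiegel, §1 (1.1) p. 3] [cite: MontgomeryVaughan2007, Thm 11.4 (11.7)] -/
theorem eq11 :
    ∃ c₀ : ℝ, 0 < c₀ ∧ ∃ c₁ : ℝ, 0 < c₁ ∧ ∀ (D : ℕ) [NeZero D] (χ : DirichletCharacter ℂ D),
      3 ≤ D → χ.IsQuadratic → χ.IsPrimitive → ¬ HasLandauSiegelZero c₀ D χ →
        c₁ * (Real.log D)⁻¹ ≤ ‖χ.LFunction 1‖ := by
  obtain ⟨c, hc, C, hC0, h⟩ :=
    MontgomeryVaughan2007_thm11_4_LOne.of_log MontgomeryVaughan2007_thm11_4_LOne_holds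
  refine ⟨2 * c, by positivity, 1 / (C + 1), by positivity, fun D _ χ hD hq hp hno => ?_⟩
  have hne : χ ≠ 1 := Skeleton.ne_one_of_isPrimitive_of_three_le hp hD
  have hlog : 1 < Real.log D := one_lt_log hD
  have hlog0 : 0 < Real.log D := by linarith
  -- no zero on `[1 − c/log D, 1)`: such a zero would be a Landau–Siegel zero for `c₀ = 2c`
  have hfree : ∀ β : ℝ, 1 - c / Real.log D ≤ β → β < 1 → χ.LFunction (β : ℂ) ≠ 0 := by
    intro β hβ hβ1 h0
    refine hno ⟨β, hβ1, h0, ?_⟩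
    have : c / Real.log D < 2 * c * (Real.log D)⁻¹ := by
      rw [← div_eq_mul_inv, div_lt_div_iff_of_pos_right hlog0]; linarith
    linarith
  have hinv := h D χ (by omega) hne hfree
  have hL0 : 0 < ‖χ.LFunction 1‖ :=
    norm_pos_iff.mpr (χ.LFunction_ne_zero_of_one_le_re (Or.inl hne) (by simp))
  -- `1/‖L‖ ≤ C log D ≤ (C+1) log D` ⇒ `‖L‖ ≥ 1/((C+1) log D)`
  have h1 : ‖χ.LFunction 1‖⁻¹ ≤ (C + 1) * Real.log D := by
    refine hinv.trans ?_; gcongr; linarith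
  have h2 : 0 < (C + 1) * Real.log D := by positivity
  rw [show 1 / (C + 1) * (Real.log D)⁻¹ = ((C + 1) * Real.log D)⁻¹ by
    rw [mul_inv, one_div]]
  exact inv_le_of_inv_le₀ hL0 h1

end Literature.NumberTheory.LFunctions.Zhang2022.Section1
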